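import Summits.Langlands.Langlands.Theorems.PhantomRMYoshidaResiduallyYoshidaLiftingSplit
import Summits.Langlands.Langlands.Theorems.PhantomRMYoshidaResiduallyYoshidaLiftingRibetRealisation
import Summits.Langlands.Langlands.Theorems.PhantomRMYoshidaResiduallyYoshidaLiftingRibetNonsplitLattice
import HarnessLib

/-!
# The anchor from an automorphic realiser of the SAME projective class (stub `stub_anchorOfSameClass`) and the CYCLIC case
# of R1c-K (stub `stub_selmerAnchorKlingen_of_cyclic`) — line `sector-klingen-split`, crux `ResiduallyYoshidaLifting`

Stub-worker of lead prover-line-stmt-Langlands-13639-c3-0 (wave 2, 2026-08-17), skeleton rev 5.  In the non-split-lattice geometry the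
crux's relative datum `ρ₀` (an automorphic irreducible `Sh`-point on the fibre) is NOT idle: it realises its own class `[B_{ρ₀}]` (Ribet
R1a, p142340), realisation depends only on the projective class `kˣ·[B] + coboundaries` (p140957), so every class projectively equal
to one realised by an automorphic `Sh`-point is ANCHORED by that point (with Klingen parameter `c = 1`); on CYCLIC fibres (all
realisable non-trivial classes projectively equal) the anchor stub R1c-K holds outright.
-/

noncomputable section

set_option linter.dupNamespace false
set_option autoImplicit false

open IsDedekindDomain Filter
open Literature.NumberTheory.GaloisRepresentations Literature.NumberTheory.Automorphic
open Summit.Langlands.Langlands.Cruxes.ResiduallyYoshidaLifting.YoshidaDivisorSelmerCount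
open Summit.Langlands.Langlands.Cruxes.ResiduallyYoshidaLifting.SectorSplit

namespace Summit.Langlands.Langlands.Cruxes.ResiduallyYoshidaLifting.SectorKlingenSplit

/-- **Registered statement `stub_anchorOfSameClass`**: an automorphic `Sh`-point `ρ₀` realising `B₀` anchors (in the sense of the
R1c-K conclusion, Klingen parameter `c = 1`) every cocycle `B = c • B₀ + (σ X - X σ')` of the same projective class. [folklore] -/
theorem stub_anchorOfSameClass :
    ∀ (p : ℕ) [Fact p.Prime], p ≠ 2 → ∀ (k : Type) [Field k] [CharP k p] [IsAlgClosed k]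
    [TopologicalSpace k] [DiscreteTopology k] (red : Valued.integer (PadicAlgCl p) →+* k)
    (σ σ' : FramedGaloisRep ℚ k 2) (hcpt : isCompact_glFiniteIntegralLevel 4 ℚ) (ι : PadicAlgCl p ≃+* ℂ)
    (ρ₀ : FramedGaloisRep ℚ (PadicAlgCl p) 4) (B₀ B : Field.absoluteGaloisGroup ℚ → Matrix (Fin 2) (Fin 2) k),
    ρ₀.toGaloisRep.IsIrreducible → Sh p k red σ σ' ρ₀ → Aut p hcpt ι ρ₀ →
    (∃ (P : GL (Fin 4) (PadicAlgCl p))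
        (rint : Field.absoluteGaloisGroup ℚ →* GL (Fin 4) (Valued.integer (PadicAlgCl p))) (h : GL (Fin 4) k),
        (∀ g, Matrix.GeneralLinearGroup.map (Valued.integer (PadicAlgCl p)).subtype (rint g) = P⁻¹ * ρ₀ g * P) ∧
        (∀ g, (Matrix.GeneralLinearGroup.map red (rint g)).val =
          h.val * Matrix.reindex finSumFinEquiv finSumFinEquiv
            (Matrix.fromBlocks (σ g).val (B₀ g) 0 (σ' g).val) * (h⁻¹).val)) →
    (∃ (c : kˣ) (X : Matrix (Fin 2) (Fin 2) k), ∀ g, B g = (c : k) • B₀ g + ((σ g).val * X - X * (σ' g).val)) →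
    ∃ ρ₁ : FramedGaloisRep ℚ (PadicAlgCl p) 4, ρ₁.toGaloisRep.IsIrreducible ∧ Aut p hcpt ι ρ₁ ∧
      (∃ c : ℕ, (c : ZMod (p - 1)) = 1 ∧
        (∃ ν : Field.absoluteGaloisGroup ℚ → PadicAlgCl p, ρ₁.IsSymplecticWithMultiplierFun ν) ∧
        ∀ v : HeightOneSpectrum (NumberField.RingOfIntegers ℚ), ((p : ℕ) : NumberField.RingOfIntegers ℚ) ∈ v.asIdeal →
          ρ₁.IsGreenbergOrdinaryOfShapeAt v ![0, 0, c, c] ∧ ρ₁.IsResiduallyDistinguishedAt v ![0, 0, c, c]) ∧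
      ∃ (P : GL (Fin 4) (PadicAlgCl p))
        (rint : Field.absoluteGaloisGroup ℚ →* GL (Fin 4) (Valued.integer (PadicAlgCl p))) (h : GL (Fin 4) k),
        (∀ g, Matrix.GeneralLinearGroup.map (Valued.integer (PadicAlgCl p)).subtype (rint g) = P⁻¹ * ρ₁ g * P) ∧
        (∀ g, (Matrix.GeneralLinearGroup.map red (rint g)).val =
          h.val * Matrix.reindex finSumFinEquiv finSumFinEquiv
            (Matrix.fromBlocks (σ g).val (B g) 0 (σ' g).val) * (h⁻¹).val) := by
  intro p _ _hp k _ _ _ _ _ red σ σ' hcpt ι ρ₀ B₀ B hρ hSh hAut hreal hcls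
  obtain ⟨P, rint, h, hfr, hred⟩ := hreal
  obtain ⟨c, X, hB⟩ := hcls
  -- realisation depends only on the projective class (Ribet package, p140957): new residual conjugator `h'`
  obtain ⟨h', hh'⟩ := Ribet.realises_smul_add_coboundary (e := finSumFinEquiv)
    (ρk := fun g => (Matrix.GeneralLinearGroup.map red (rint g)).val)
    (S := fun g => (σ g).val) (S' := fun g => (σ' g).val) B₀ h c X hred
  -- the anchor is `ρ₀` itself, Klingen parameter `c = 1` (shape `(0,0,1,1)` = the `Sh` Greenberg clause)
  refine ⟨ρ₀, hρ, hAut, ⟨1, by simp, ⟨_, hSh.1⟩, fun v hv => hSh.2.1 v hv⟩, P, rint, h', hfr, fun g => ?_⟩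
  rw [hB g]
  exact hh' g

/-- **Registered statement `stub_selmerAnchorKlingen_of_cyclic`**: on a fibre carrying an automorphic irreducible `Sh`-point `ρ₀`
and whose realisable non-trivial classes are all projectively equal (CYCLIC fibre), the anchor stub R1c-K of skeleton rev 5 holds
(with anchor `ρ₀`, `c = 1`). [folklore] -/
theorem stub_selmerAnchorKlingen_of_cyclic :
    ∀ (p : ℕ) [Fact p.Prime], p ≠ 2 → ∀ (k : Type) [Field k] [CharP k p] [IsAlgClosed k]
    [TopologicalSpace k] [DiscreteTopology k] (red : Valued.integer (PadicAlgCl p) →+* k)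
    (σ σ' : FramedGaloisRep ℚ k 2) (hcpt : isCompact_glFiniteIntegralLevel 4 ℚ) (ι : PadicAlgCl p ≃+* ℂ),
    σ.toGaloisRep.IsIrreducible → σ'.toGaloisRep.IsIrreducible →
    (¬ ∃ g : GL (Fin 2) k, ∀ x, g * σ x * g⁻¹ = σ' x) →
    (∃ ρ₀ : FramedGaloisRep ℚ (PadicAlgCl p) 4, ρ₀.toGaloisRep.IsIrreducible ∧ Sh p k red σ σ' ρ₀ ∧ Aut p hcpt ι ρ₀) →
    (∀ B₁ B₂ : Field.absoluteGaloisGroup ℚ → Matrix (Fin 2) (Fin 2) k,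
      (¬ ∃ X : Matrix (Fin 2) (Fin 2) k, ∀ g, B₁ g = (σ g).val * X - X * (σ' g).val) →
      (¬ ∃ X : Matrix (Fin 2) (Fin 2) k, ∀ g, B₂ g = (σ g).val * X - X * (σ' g).val) →
      (∃ ρ : FramedGaloisRep ℚ (PadicAlgCl p) 4, ρ.toGaloisRep.IsIrreducible ∧ Sh p k red σ σ' ρ ∧
        ∃ (P : GL (Fin 4) (PadicAlgCl p))
          (rint : Field.absoluteGaloisGroup ℚ →* GL (Fin 4) (Valued.integer (PadicAlgCl p))) (h : GL (Fin 4) k),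
          (∀ g, Matrix.GeneralLinearGroup.map (Valued.integer (PadicAlgCl p)).subtype (rint g) = P⁻¹ * ρ g * P) ∧
          (∀ g, (Matrix.GeneralLinearGroup.map red (rint g)).val =
            h.val * Matrix.reindex finSumFinEquiv finSumFinEquiv
              (Matrix.fromBlocks (σ g).val (B₁ g) 0 (σ' g).val) * (h⁻¹).val)) →
      (∃ ρ : FramedGaloisRep ℚ (PadicAlgCl p) 4, ρ.toGaloisRep.IsIrreducible ∧ Sh p k red σ σ' ρ ∧
        ∃ (P : GL (Fin 4) (PadicAlgCl p))
          (rint : Field.absoluteGaloisGroup ℚ →* GL (Fin 4) (Valued.integer (PadicAlgCl p))) (h : GL (Fin 4) k),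
          (∀ g, Matrix.GeneralLinearGroup.map (Valued.integer (PadicAlgCl p)).subtype (rint g) = P⁻¹ * ρ g * P) ∧
          (∀ g, (Matrix.GeneralLinearGroup.map red (rint g)).val =
            h.val * Matrix.reindex finSumFinEquiv finSumFinEquiv
              (Matrix.fromBlocks (σ g).val (B₂ g) 0 (σ' g).val) * (h⁻¹).val)) →
      ∃ (c : kˣ) (X : Matrix (Fin 2) (Fin 2) k), ∀ g, B₂ g = (c : k) • B₁ g + ((σ g).val * X - X * (σ' g).val)) →
    ∀ (B : Field.absoluteGaloisGroup ℚ → Matrix (Fin 2) (Fin 2) k),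
    DetC p k σ σ' → GenericSector p k σ σ' →
    (¬ ∃ X : Matrix (Fin 2) (Fin 2) k, ∀ g, B g = (σ g).val * X - X * (σ' g).val) →
    (∃ ρ : FramedGaloisRep ℚ (PadicAlgCl p) 4, ρ.toGaloisRep.IsIrreducible ∧ Sh p k red σ σ' ρ ∧
      ∃ (P : GL (Fin 4) (PadicAlgCl p))
        (rint : Field.absoluteGaloisGroup ℚ →* GL (Fin 4) (Valued.integer (PadicAlgCl p))) (h : GL (Fin 4) k),
        (∀ g, Matrix.GeneralLinearGroup.map (Valued.integer (PadicAlgCl p)).subtype (rint g) = P⁻¹ * ρ g * P) ∧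
        (∀ g, (Matrix.GeneralLinearGroup.map red (rint g)).val =
          h.val * Matrix.reindex finSumFinEquiv finSumFinEquiv
            (Matrix.fromBlocks (σ g).val (B g) 0 (σ' g).val) * (h⁻¹).val)) →
    ∃ ρ₁ : FramedGaloisRep ℚ (PadicAlgCl p) 4, ρ₁.toGaloisRep.IsIrreducible ∧ Aut p hcpt ι ρ₁ ∧
      (∃ c : ℕ, (c : ZMod (p - 1)) = 1 ∧
        (∃ ν : Field.absoluteGaloisGroup ℚ → PadicAlgCl p, ρ₁.IsSymplecticWithMultiplierFun ν) ∧
        ∀ v : HeightOneSpectrum (NumberField.RingOfIntegers ℚ), ((p : ℕ) : NumberField.RingOfIntegers ℚ) ∈ v.asIdeal →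
          ρ₁.IsGreenbergOrdinaryOfShapeAt v ![0, 0, c, c] ∧ ρ₁.IsResiduallyDistinguishedAt v ![0, 0, c, c]) ∧
      ∃ (P : GL (Fin 4) (PadicAlgCl p))
        (rint : Field.absoluteGaloisGroup ℚ →* GL (Fin 4) (Valued.integer (PadicAlgCl p))) (h : GL (Fin 4) k),
        (∀ g, Matrix.GeneralLinearGroup.map (Valued.integer (PadicAlgCl p)).subtype (rint g) = P⁻¹ * ρ₁ g * P) ∧
        (∀ g, (Matrix.GeneralLinearGroup.map red (rint g)).val =
          h.val * Matrix.reindex finSumFinEquiv finSumFinEquiv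
            (Matrix.fromBlocks (σ g).val (B g) 0 (σ' g).val) * (h⁻¹).val) := by
  intro p _ hp k _ _ _ _ _ red σ σ' hcpt ι hσ hσ' hnc hρ₀ hcyc B _hdet _hG hncB hreal
  obtain ⟨ρ₀, hρ₀irr, hSh₀, hAut₀⟩ := hρ₀
  -- Ribet R1a (p142340): `ρ₀` realises its own NON-coboundary class `B₀`
  obtain ⟨P₀, rint₀, h₀, B₀, hfr₀, hred₀, hncB₀⟩ :=
    Ribet.stub_ribetNonsplitLattice p k red σ σ' ρ₀ hσ hσ' hnc hρ₀irr hSh₀.2.2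
  -- cyclicity: `B` is projectively equal to `B₀`
  obtain ⟨c, X, hB⟩ := hcyc B₀ B hncB₀ hncB ⟨ρ₀, hρ₀irr, hSh₀, P₀, rint₀, h₀, hfr₀, hred₀⟩ hreal
  exact stub_anchorOfSameClass p hp k red σ σ' hcpt ι ρ₀ B₀ B hρ₀irr hSh₀ hAut₀ ⟨P₀, rint₀, h₀, hfr₀, hred₀⟩
    ⟨c, X, hB⟩

end Summit.Langlands.Langlands.Cruxes.ResiduallyYoshidaLifting.SectorKlingenSplit

end
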